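import Literature.MathematicalPhysics.QuantumFieldTheory.Balaban1983to89.B12Form543

/-!
# Bałaban CMP 109 (1987) §5 pp. 292–293: the covariance (5.2)–(5.4) ⇒ (5.6), (5.7), (5.8) and the gauge
invariance (4.15)₁ ⇒ (5.9), as a kernel-checked DICTIONARY between invariances of the quadratic form (5.43)
and the typed kernel hypotheses of the B12 lineage; (5.43) complete from (5.10) + invariances of the form

CITATION HEADER (lean-in-tree rule 2026-08-18).
* Source: T. Bałaban, "Renormalization group approach to lattice gauge field theories. I. Generation of
  effective actions in a small field approximation and a coupling constant renormalization in four
  dimensions", Commun. Math. Phys. 109 (1987) 249–301 [Balaban1987RG1], §5 "Polarization tensor",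
  pp. 292–293, displays (5.2)–(5.9); §4 p. 284, display (4.15) first line; §5 p. 297 (5.43)–(5.44) (through
  the imported `…B12Form543`).  Quotations below were read from the page renders of the cell
  (`b2b-balaban-ref1/pages/1987-cmp109-rg-I-small-field-p036/p044/p045-x2.png` = pp. 284/292/293); inside
  quotation marks nothing is altered (in particular (5.4)–(5.9) print `Π` WITHOUT a tilde, G-ref5-91).
* Statements reproduced (verbatim).  p. 292: *"This representation is basic for the further analysis,
  because it implies symmetries of the tensor. The function 𝐄^{(j)}(U_j(exp iB)) is invariant with respect
  to all Euclidean symmetries r of the lattice T₁^{(j)},"* (5.2) *"𝐄^{(j)}(U_j(exp irB)) = 𝐄^{(j)}(rU_j(exp iB))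
  = 𝐄^{(j)}(U_j(exp iB)),"* *"where the fields rU, rB are defined by the identity (rU)(rb) = U(b), hence"* (5.3)
  *"(rU)(b) = U(r⁻¹b), (rB)(b) = B(r⁻¹b)."* *"The invariance (5.2) yields the following covariant
  transformation law for the polarization tensor:"* (5.4) *"Π(rb, rb′) = Π(b, b′),"* *"where Π is extended to
  negatively oriented bonds by the equality Π(−b, b′) = −Π(b, b′), similarly for the second argument."* (5.5)
  *"Π_{μν}(x, y) = Π(⟨x, x + e_μ⟩, ⟨y, y + e_ν⟩)."* *"If r is a transformation defined by a permutation π: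
  (rx)_μ = x_{π⁻¹(μ)}, then the equality (5.4) can be written as"* (5.6) *"Π_{μν}(rx, ry) = Π_{π⁻¹(μ),π⁻¹(ν)}(x, y)
  = ((r⊗r)Π)_{μν}(x, y)."*  p. 293: *"If r is a reflection in a part of the components of x: rx = εx,
  (εx)_μ = ε_μx_μ, ε_μ = ±1, μ = 1, …, d, then (5.4) can be written as Π(⟨εx, εx + ε_μe_μ⟩, ⟨εy, εy + ε_νe_ν⟩)
  = Π(⟨x, x + e_μ⟩, ⟨y, y + e_ν⟩). This and the definition (5.5) yield"* (5.7) *"Π_{μν}(εx − ((1−ε_μ)/2)e_μ,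
  εy − ((1−ε_ν)/2)e_ν) = ε_με_νΠ_{μν}(x, y)."* *"The function Π is also translation invariant and symmetric,
  hence"* (5.8) *"Π_{μν}(x, y) = Π_{μν}(x − y), Π_{μν}(x) = Π_{νμ}(−x)."* *"The gauge invariance, expressed in the
  first identity (4.15), implies"* (5.9) *"Σ_μ ∂*_μΠ_{μν}(x − y) = Σ_ν ∂_νΠ_{μν}(x − y) = 0."*  p. 284: *"We obtain
  the following set of Ward-Takahashi identities"* (4.15), first line: *"⟨(δ²/δB²)𝐄(1), B₁, ∂λ⟩ = 0,"* … *"for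
  an arbitrary gauge function λ, and arbitrary gauge fields B₁, B₂, B₃."*
* Proof route: the paper states (5.4) ⇒ (5.6), (5.7) ("can be written as", "yield") and (4.15)₁ ⇒ (5.9)
  ("implies") without displayed proofs.  This module supplies that algebra, by elementary re-indexing of
  finitely supported lattice sums and summation by parts (the author of this file's own argument; no step of
  the manuscript under audit is used as a hypothesis), at the level of the translation-invariant quadratic form
  `B12Form543.form K a b = Σ_{μν} Σ_{x,y} K_{μν}(x − y) a_μ(x) b_ν(y)` of (5.43), for an ARBITRARY complex
  kernel family `K` — and then specialises to the complexification `ofRealK Π` of a real B12 kernel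
  `Π : B12Beta.Kernel d`, where the invariances become, by name, the lineage's typed hypotheses
  `B12Beta.PermCovariant`, `B12Transverse536.ReflCovariant`, `B12Transverse536.WardFirst` used in
  `B12Form543.form543_of_symmetries` ((5.43) complete).  §7 records the abstract fact behind (5.2) ⇒ (5.4):
  a `C²` function invariant under a continuous linear map has an invariant second derivative at `0`
  (Mathlib `ContinuousLinearMap.iteratedFDeriv_comp_right`).

DICTIONARY (paper ↦ Lean; lattice `Pt d = Fin d → ℤ` of `…GawedzkiKupiainen1985.PeriodicGleason`, no
periodisation — the cell's standing infinite-lattice reading of §5, cf. `…B12Sec2to5`, `…B12Rep537`).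
* a permutation symmetry `r`, "(rx)_μ = x_{π⁻¹(μ)}" ↦ `permPt π x := fun j => x (π.symm j)`
  (`permPt_unitVec : permPt π e_μ = e_{π μ}`); a reflection "rx = εx" with `ε_ρ = −1`, `ε_μ = 1 (μ ≠ ρ)` ↦
  `reflPt ρ` (the single-axis reflections generate all `ε`; `ε_μ` ↦ `B12Transverse536.rsgn ρ μ`); the shift
  "((1−ε_ν)/2)e_ν" ↦ `sv ρ ν`; the point map of (5.7) "εy − ((1−ε_ν)/2)e_ν" ↦ `twist ρ ν y`.
* a bond field `B` on positively oriented bonds, `B_μ(x) = B(⟨x, x + e_μ⟩)` ↦ `a : Fin d → Pt d → ℂ`; its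
  odd extension to ordered nearest-neighbour pairs (`B(⟨x′,x⟩) = −B(⟨x,x′⟩)`, the series' convention,
  Bałaban CMP 95 (1984) (1.2)/(1.4), cell NOTATION.md §2.2; for the tensor p. 292 "Π(−b, b′) = −Π(b, b′)")
  ↦ `obval a u v`; (5.3) "(rB)(b) = B(r⁻¹b)" ↦ `pull s a` with `s = r⁻¹` acting on points
  (`pull_permPt`, `pull_reflPt`, `pull_trans` compute it: `permAct`, `reflAct`, `transAct`).
* "Π_{μν}(x − y)" ((5.5), (5.8)₁) ↦ a kernel family `K μ ν z` (`z = x − y`), real B12 kernels through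
  `B12Form543.ofRealK`; the pairing of `Π` with two bond fields ((5.43) left side, (5.1)) ↦
  `B12Form543.form K a b`.
* (5.6) ↦ `permK π K = K` (`permK_eq_iff_printed` is the displayed two-point form) ↦ for real kernels
  `B12Beta.PermCovariant` (`permCovariant_iff`); (5.7) ↦ `reflTwK ρ K = K` (`reflTwK_eq_iff_printed` is the
  displayed form; the lineage's `B12Transverse536.reflTwist ρ μ ν` is its difference-variable version,
  `twist_sub_twist`) ↦ `B12Transverse536.ReflCovariant` (`reflCovariant_iff`); (5.8)₂ ↦ `swapK K = K`
  (`swapK_eq_iff`, `symmetric_iff`); (5.8)₁ is built into `form` (`form_transAct`).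
* "∂λ" (a pure gauge, forward gradient) ↦ `B12Pairing543.grad lam = fun μ => fdelta μ lam`; "∂*_μ" (p. 293
  (5.9), backward-looking) ↦ `PeriodicGleason.delta μ`; "∂_ν" ↦ `B12Rep537.fdelta ν`; (5.9)₁
  "Σ_μ ∂*_μΠ_{μν} = 0" ↦ `B12Transverse536.WardB K` / `WardFirst Π`; (5.9)₂ "Σ_ν ∂_νΠ_{μν} = 0" ↦
  `B12WardLeadingForm.WardB₂ K`; (4.15)₁ "⟨(δ²/δB²)𝐄(1), B₁, ∂λ⟩ = 0" at the level of the form ↦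
  `form K (grad lam) b = 0` (gauge slot first, as in `…B12Ward414.hessian_apply_generator_eq_zero`, or second:
  both readings are treated, `wardB_iff_gauge_left`, `wardB₂_iff_gauge_right`).

WHAT IS PROVED (kernel-checked, no `sorry`, standard axioms).
1. §1–§2: the point maps and their algebra (`permPt_unitVec`, `reflPt_unitVec_self : ε e_ρ = −e_ρ`,
   `twist_twist`, `reflTwist_eq`, `twist_sub_twist : T_{ρ;μ}x − T_{ρ;ν}y = reflTwist ρ μ ν (x − y)`); the odd
   extension (`obval_bond`, `obval_bond_rev`, `obval_swap`) and (5.3) COMPUTED for the generators: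
   `pull_permPt : pull (permPt π⁻¹) B = permAct π B` ((r_πB)_ν(y) = B_{π⁻¹ν}(r_π⁻¹y), no sign) and
   `pull_reflPt : pull (reflPt ρ) B = reflAct ρ B` ((εB)_ν(y) = ε_ν B_ν(εy − ((1−ε_ν)/2)e_ν)) — the sign
   `ε_ν` and the shift of (5.7) are the ones FORCED by (5.3) and the orientation convention (this is the
   bookkeeping behind "This and the definition (5.5) yield (5.7)", certified here); `pull_trans`.
2. §3: transformation of the form: `form_permAct`, `form_reflAct`, `form_swap`, `form_transAct`, and
   `kernel_eq_of_form_eq` (the form on finitely supported fields determines the kernel, by bond test fields).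
3. §4–§5, the dictionary proper, each an `↔` over all finitely supported complex fields:
   `permK_eq_iff` / `permK_eq_iff_printed` ((5.4) for `r_π` ⇔ (5.6)), `reflTwK_eq_iff` /
   `reflTwK_eq_iff_covariant` / `reflTwK_eq_iff_printed` ((5.4) for `ε` ⇔ (5.7)), `swapK_eq_iff`
   (symmetry ⇔ (5.8)₂); for real B12 kernels `permCovariant_iff`, `reflCovariant_iff`, `symmetric_iff`.
4. §6: summation by parts `spair_fdelta_kernel_right`; `form_grad_left`, `form_grad_right`; the Ward
   dictionary `wardB_iff_gauge_left : WardB K ↔ ∀ λ b, form K (∂λ) b = 0`, `wardB₂_iff_gauge_right :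
   WardB₂ K ↔ ∀ a λ, form K a (∂λ) = 0`, `wardFirst_iff_wardB`, `wardFirst_iff_gauge_left`, and
   `wardB₂_iff_wardB_of_symmetric` ((5.9)₂ ⇔ (5.9)₁ under (5.8)₂).
5. §7: `iteratedFDeriv_two_invariant`, `hessian_invariant` (f ∘ L = f, f ∈ C² ⇒ D²f(0)(Lv, Lw) =
   D²f(0)(v, w)) — the abstract content of (5.2) ⇒ (5.4).
6. §8 capstone `form543_of_invariance`: (5.10) for every component + invariance of `form (ofRealK Π)` under
   `pull (permPt π⁻¹)` (all `π`) and `pull (reflPt ρ)` (all `ρ`) in both fields + `form (ofRealK Π) (∂λ) b = 0`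
   + `μ₀ ≠ ν₀` ⇒ the conclusion of `B12Form543.form543_of_symmetries`: (5.43) with
   `β = Σ_x Π_{μ₀ν₀}(x) x_{μ₀} x_{ν₀}` and the uniform (5.44)-type remainder bound.

WHAT IS NOT PROVED HERE (and not claimed).  (5.2) itself — the invariance of `𝐄^{(j)}(U_j(exp iB))` under the
lattice symmetries and under gauge transformations is a property of the inductive construction of [15–17] and
of §4, recorded by the lineage only as hypotheses; the identification of `Π` with the Hessian (5.1) of that
functional (§7 is the abstract shape only); composite symmetries (general `ε`, `r = ε ∘ r_π`): only the
generators are treated — invariance under composites follows by iterating `form_permAct` / `form_reflAct` but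
no group action is formalised; periodisation / the torus `T_1^{(j)}` (infinite-lattice reading, as in the whole
B12 lineage); anything about `β`'s sign or value ((5.45) ff., owned by the `strat-b12` / beta seats).

Value = kernel certificate of textbook-level algebra ((5.3) sign bookkeeping, re-indexing, summation by
parts) that the paper leaves to the reader, wired by name into the lineage's (5.43); NOT summit progress.
-/

namespace Literature.MathematicalPhysics.QuantumFieldTheory.Balaban1983to89.B12Covariance54

noncomputable section

open Literature.MathematicalPhysics.QuantumFieldTheory.GawedzkiKupiainen1985.PeriodicGleason
open Literature.MathematicalPhysics.QuantumFieldTheory.Balaban1983to89.B12Rep537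
open Literature.MathematicalPhysics.QuantumFieldTheory.Balaban1983to89.B12Transverse536
open Literature.MathematicalPhysics.QuantumFieldTheory.Balaban1983to89.B12WardLeadingForm
open Literature.MathematicalPhysics.QuantumFieldTheory.Balaban1983to89.B12Pairing543
open Literature.MathematicalPhysics.QuantumFieldTheory.Balaban1983to89.B12Pairing543Backward
open Literature.MathematicalPhysics.QuantumFieldTheory.Balaban1983to89.B12Form543

variable {d : ℕ}

/-! ## §1 The lattice symmetries on points: axis permutations, single-axis reflections -/

/-- The value of the unit vector `e_μ`. [folklore] -/
theorem unitVec_apply (μ j : Fin d) : (unitVec μ : Pt d) j = if j = μ then 1 else 0 := rfl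

/-- Unit vectors are distinct for distinct axes. [folklore] -/
theorem unitVec_inj {μ μ' : Fin d} : (unitVec μ : Pt d) = unitVec μ' ↔ μ = μ' := by
  refine ⟨fun h => ?_, fun h => h ▸ rfl⟩
  by_contra hne
  have := congrFun h μ
  simp only [unitVec_apply, if_true, if_neg hne] at this
  exact one_ne_zero this

/-- `u + e_μ = u + e_μ'` iff `μ = μ'`. [folklore] -/
theorem add_unitVec_inj {u : Pt d} {μ μ' : Fin d} : u + unitVec μ = u + unitVec μ' ↔ μ = μ' := by
  rw [add_right_inj, unitVec_inj]

/-- No point is two positive unit steps away from itself. [folklore] -/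
theorem ne_add_unitVec_add_unitVec (u : Pt d) (μ μ' : Fin d) : ¬ u = u + unitVec μ + unitVec μ' := by
  intro h
  have := congrFun h μ
  simp only [Pi.add_apply, unitVec_apply, if_true] at this
  split_ifs at this <;> omega

/-- **Axis permutation on points** (p. 292, before (5.6): "(rx)_μ = x_{π^{-1}(μ)}"): `r_π x = x ∘ π⁻¹`.
[cite: Balaban1987RG1, (5.6) p.292] -/
def permPt (σ : Equiv.Perm (Fin d)) (x : Pt d) : Pt d := fun j => x (σ.symm j)

/-- Components of `r_π x`. [cite: Balaban1987RG1, (5.6) p.292] -/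
@[simp] theorem permPt_apply (σ : Equiv.Perm (Fin d)) (x : Pt d) (j : Fin d) : permPt σ x j = x (σ.symm j) :=
  rfl

/-- `r_π` is additive. [folklore] -/
theorem permPt_add (σ : Equiv.Perm (Fin d)) (x y : Pt d) : permPt σ (x + y) = permPt σ x + permPt σ y := rfl

/-- `r_π` commutes with subtraction. [folklore] -/
theorem permPt_sub (σ : Equiv.Perm (Fin d)) (x y : Pt d) : permPt σ (x - y) = permPt σ x - permPt σ y := rfl

/-- `r_π 0 = 0`. [folklore] -/
@[simp] theorem permPt_zero (σ : Equiv.Perm (Fin d)) : permPt σ (0 : Pt d) = 0 := rfl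

/-- `r_{π⁻¹} r_π = 1`. [folklore] -/
@[simp] theorem permPt_symm_permPt (σ : Equiv.Perm (Fin d)) (x : Pt d) : permPt σ.symm (permPt σ x) = x := by
  funext j; simp [permPt]

/-- `r_π r_{π⁻¹} = 1`. [folklore] -/
@[simp] theorem permPt_permPt_symm (σ : Equiv.Perm (Fin d)) (x : Pt d) : permPt σ (permPt σ.symm x) = x := by
  funext j; simp [permPt]

/-- **`r_π e_μ = e_{π(μ)}`** (so `r_π` maps the bond `⟨x, x+e_μ⟩` to the POSITIVE bond `⟨r_πx, r_πx + e_{π(μ)}⟩`).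
[cite: Balaban1987RG1, (5.6) p.292] -/
theorem permPt_unitVec (σ : Equiv.Perm (Fin d)) (μ : Fin d) : permPt σ (unitVec μ) = unitVec (σ μ) := by
  funext j
  simp only [permPt_apply, unitVec_apply, Equiv.symm_apply_eq]

/-- `r_π` as a bijection of the lattice. [folklore] -/
def permEquiv (σ : Equiv.Perm (Fin d)) : Pt d ≃ Pt d where
  toFun := permPt σ
  invFun := permPt σ.symm
  left_inv := permPt_symm_permPt σ
  right_inv := permPt_permPt_symm σ

/-- **Reflection of the `ρ`-th axis on points** (p. 293: "rx = εx, (εx)_μ = ε_μx_μ, ε_μ = ±1" with `ε_ρ = −1`, all other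
`ε_μ = 1`; these generate all `ε`). [cite: Balaban1987RG1, (5.7) p.293] -/
def reflPt (ρ : Fin d) (x : Pt d) : Pt d := Function.update x ρ (-x ρ)

/-- The reflected component. [folklore] -/
@[simp] theorem reflPt_self (ρ : Fin d) (x : Pt d) : reflPt ρ x ρ = -x ρ := Function.update_self ..

/-- The other components. [folklore] -/
@[simp] theorem reflPt_of_ne {ρ j : Fin d} (h : j ≠ ρ) (x : Pt d) : reflPt ρ x j = x j :=
  Function.update_of_ne h ..

/-- `ε` is additive. [folklore] -/
theorem reflPt_add (ρ : Fin d) (x y : Pt d) : reflPt ρ (x + y) = reflPt ρ x + reflPt ρ y := by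
  funext j
  by_cases h : j = ρ
  · subst h; simp only [Pi.add_apply, reflPt_self, neg_add]
  · simp [h]

/-- `ε` commutes with negation. [folklore] -/
theorem reflPt_neg (ρ : Fin d) (x : Pt d) : reflPt ρ (-x) = -reflPt ρ x := by
  funext j
  by_cases h : j = ρ
  · subst h; simp
  · simp [h]

/-- `ε` commutes with subtraction. [folklore] -/
theorem reflPt_sub (ρ : Fin d) (x y : Pt d) : reflPt ρ (x - y) = reflPt ρ x - reflPt ρ y := by
  rw [sub_eq_add_neg, reflPt_add, reflPt_neg, ← sub_eq_add_neg]

/-- `ε` is an involution. [folklore] -/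
@[simp] theorem reflPt_reflPt (ρ : Fin d) (x : Pt d) : reflPt ρ (reflPt ρ x) = x := by
  funext j
  by_cases h : j = ρ
  · subst h; simp
  · simp [h]

/-- **`ε e_ρ = −e_ρ`** (the reflected axis: the bond `⟨x, x+e_ρ⟩` goes to the NEGATIVELY oriented bond
`⟨εx, εx − e_ρ⟩`). [cite: Balaban1987RG1, (5.7) p.293] -/
theorem reflPt_unitVec_self (ρ : Fin d) : reflPt ρ (unitVec ρ : Pt d) = -unitVec ρ := by
  funext j
  by_cases h : j = ρ
  · subst h; simp [unitVec_apply]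
  · simp [h, unitVec_apply]

/-- `ε e_ν = e_ν` for `ν ≠ ρ`. [cite: Balaban1987RG1, (5.7) p.293] -/
theorem reflPt_unitVec_of_ne {ρ ν : Fin d} (h : ν ≠ ρ) : reflPt ρ (unitVec ν : Pt d) = unitVec ν := by
  funext j
  by_cases hj : j = ρ
  · subst hj; simp [unitVec_apply, Ne.symm h]
  · simp [hj, unitVec_apply]

/-- The bond shift `((1 − ε_ν)/2) e_ν` of (5.7) for the reflection of the `ρ`-th axis: `e_ρ` if `ν = ρ`, else `0`.
[cite: Balaban1987RG1, (5.7) p.293] -/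
def sv (ρ ν : Fin d) : Pt d := if ν = ρ then unitVec ρ else 0

/-- `ε` negates the shift vector (it lies on the reflected axis). [folklore] -/
theorem reflPt_sv (ρ ν : Fin d) : reflPt ρ (sv ρ ν) = -sv ρ ν := by
  unfold sv
  split_ifs
  · exact reflPt_unitVec_self ρ
  · funext j; by_cases hj : j = ρ
    · subst hj; simp
    · simp [hj]

/-- **The point map of (5.7)**: `T_{ρ;ν} y = εy − ((1 − ε_ν)/2) e_ν` (the starting point of the positively
re-oriented image bond). [cite: Balaban1987RG1, (5.7) p.293] -/
def twist (ρ ν : Fin d) (y : Pt d) : Pt d := reflPt ρ y - sv ρ ν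

/-- `T_{ρ;ν}` is an involution. [folklore] -/
@[simp] theorem twist_twist (ρ ν : Fin d) (y : Pt d) : twist ρ ν (twist ρ ν y) = y := by
  unfold twist
  rw [reflPt_sub, reflPt_reflPt, reflPt_sv, sub_neg_eq_add, add_sub_cancel_right]

/-- `T_{ρ;ν}` as a bijection of the lattice. [folklore] -/
def twistEquiv (ρ ν : Fin d) : Pt d ≃ Pt d := Function.Involutive.toPerm (twist ρ ν) (twist_twist ρ ν)

/-- **The lineage's twisted reflection is (5.7)'s argument in the difference variable**:
`B12Transverse536.reflTwist ρ μ ν z = εz − ((1−ε_μ)/2)e_μ + ((1−ε_ν)/2)e_ν`. [cite: Balaban1987RG1, (5.7) p.293] -/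
theorem reflTwist_eq (ρ μ ν : Fin d) (z : Pt d) : reflTwist ρ μ ν z = reflPt ρ z - sv ρ μ + sv ρ ν := by
  funext j
  by_cases hj : j = ρ
  · subst hj
    rw [reflTwist_self]
    simp only [Pi.add_apply, Pi.sub_apply, reflPt_self, sv, tw]
    split_ifs <;> simp [unitVec_apply]
  · rw [reflTwist_of_ne hj]
    simp only [Pi.add_apply, Pi.sub_apply, reflPt_of_ne hj, sv]
    split_ifs <;> simp [unitVec_apply, hj]

/-- `T_{ρ;μ} x − T_{ρ;ν} y = R_{ρ;μν}(x − y)`: the two-variable form of (5.7) is the lineage's one-variable form.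
[cite: Balaban1987RG1, (5.7)/(5.8) p.293] -/
theorem twist_sub_twist (ρ μ ν : Fin d) (x y : Pt d) : twist ρ μ x - twist ρ ν y = reflTwist ρ μ ν (x - y) := by
  rw [reflTwist_eq, reflPt_sub]
  unfold twist
  abel

/-! ## §2 Oriented bonds, the odd extension of a bond field, and the action (5.3) -/

/-- **The odd extension of a bond field to ordered nearest-neighbour pairs**: a field `a` given on the positively
oriented bonds (`a_μ(x)` on `⟨x, x + e_μ⟩`) takes the value `a_μ(u)` on `⟨u, u + e_μ⟩`, `−a_μ(v)` on the reversed bond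
`⟨v + e_μ, v⟩`, and `0` on non-bonds (the series' convention `A_{⟨x,x′⟩} = −A_{⟨x′,x⟩}`, Bałaban CMP 95 (1984) p. 18
(1.2)/(1.4), cell NOTATION.md §2.2; for the tensor itself p. 292: "Π is extended to negatively oriented bonds by the
equality Π(−b,b′) = −Π(b,b′)"). [cite: Balaban1987RG1, (5.3)-(5.5) p.292] -/
def obval (a : Fin d → Pt d → ℂ) (u v : Pt d) : ℂ :=
  (∑ μ, if v = u + unitVec μ then a μ u else 0) - ∑ μ, if u = v + unitVec μ then a μ v else 0

/-- On a positive bond the extension is the field. [folklore] -/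
theorem obval_bond (a : Fin d → Pt d → ℂ) (u : Pt d) (μ : Fin d) : obval a u (u + unitVec μ) = a μ u := by
  have h2 : ∀ μ', ¬ u = u + unitVec μ + unitVec μ' := ne_add_unitVec_add_unitVec u μ
  unfold obval
  simp only [add_unitVec_inj, h2, if_false, Finset.sum_const_zero, sub_zero]
  rw [Finset.sum_ite_eq]
  simp

/-- On a reversed bond the extension is minus the field. [folklore] -/
theorem obval_bond_rev (a : Fin d → Pt d → ℂ) (v : Pt d) (μ : Fin d) : obval a (v + unitVec μ) v = -a μ v := by
  have h2 : ∀ μ', ¬ v = v + unitVec μ + unitVec μ' := ne_add_unitVec_add_unitVec v μ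
  unfold obval
  simp only [add_unitVec_inj, h2, if_false, Finset.sum_const_zero, zero_sub]
  rw [Finset.sum_ite_eq]
  simp

/-- The same with the reversed bond written `⟨u, u − e_μ⟩`. [folklore] -/
theorem obval_bond_rev' (a : Fin d → Pt d → ℂ) (u : Pt d) (μ : Fin d) :
    obval a u (u - unitVec μ) = -a μ (u - unitVec μ) := by
  have := obval_bond_rev a (u - unitVec μ) μ
  rwa [sub_add_cancel] at this

/-- The extension is odd under reversal of the pair. [cite: Balaban1987RG1, p.292 ("Π(−b,b′) = −Π(b,b′)")] -/
theorem obval_swap (a : Fin d → Pt d → ℂ) (u v : Pt d) : obval a v u = -obval a u v := by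
  unfold obval
  exact (neg_sub _ _).symm

/-- **(5.3) on bond fields**: "(rB)(b) = B(r^{-1}b)" — for a lattice symmetry whose INVERSE acts on points by `s`,
the transformed field on the positive bond `⟨y, y + e_ν⟩` is the odd extension of `B` evaluated on the image pair
`⟨s y, s(y + e_ν)⟩`. [cite: Balaban1987RG1, (5.3) p.292] -/
def pull (s : Pt d → Pt d) (a : Fin d → Pt d → ℂ) : Fin d → Pt d → ℂ :=
  fun ν y => obval a (s y) (s (y + unitVec ν))

/-- **The explicit action of an axis permutation** `r_π`: `(r_π B)_ν(y) = B_{π⁻¹(ν)}(r_π⁻¹ y)`.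
[cite: Balaban1987RG1, (5.3)/(5.6) p.292] -/
def permAct (σ : Equiv.Perm (Fin d)) (a : Fin d → Pt d → ℂ) : Fin d → Pt d → ℂ :=
  fun ν y => a (σ.symm ν) (permPt σ.symm y)

/-- **The explicit action of the reflection of the `ρ`-th axis**: `(εB)_ν(y) = ε_ν B_ν(εy − ((1−ε_ν)/2)e_ν)`.
[cite: Balaban1987RG1, (5.3)/(5.7) pp.292-293] -/
def reflAct (ρ : Fin d) (a : Fin d → Pt d → ℂ) : Fin d → Pt d → ℂ :=
  fun ν y => ((rsgn ρ ν : ℝ) : ℂ) * a ν (twist ρ ν y)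

/-- **The explicit action of the translation by `v`**: `(τ_v B)_ν(y) = B_ν(y − v)`. [cite: Balaban1987RG1, (5.8) p.293] -/
def transAct (v : Pt d) (a : Fin d → Pt d → ℂ) : Fin d → Pt d → ℂ := fun ν y => a ν (y - v)

/-- **(5.3) ⇒ the permutation action**: with `s = r_π⁻¹ = r_{π⁻¹}` on points, `pull s B = r_π B` as displayed
(the image of a positive bond is a positive bond: no sign). [cite: Balaban1987RG1, (5.3)/(5.6) p.292] -/
theorem pull_permPt (σ : Equiv.Perm (Fin d)) (a : Fin d → Pt d → ℂ) : pull (permPt σ.symm) a = permAct σ a := by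
  funext ν y
  show obval a (permPt σ.symm y) (permPt σ.symm (y + unitVec ν)) = a (σ.symm ν) (permPt σ.symm y)
  rw [permPt_add, permPt_unitVec, obval_bond]

/-- **(5.3) ⇒ the reflection action, sign bookkeeping CERTIFIED**: with `s = ε⁻¹ = ε`, `pull s B = εB` — for
`ν = ρ` the image bond `⟨εy, εy − e_ρ⟩` is negatively oriented, whence the sign `ε_ν` and the shift `((1−ε_ν)/2)e_ν`
of (5.7). [cite: Balaban1987RG1, (5.3) p.292; (5.7) p.293] -/
theorem pull_reflPt (ρ : Fin d) (a : Fin d → Pt d → ℂ) : pull (reflPt ρ) a = reflAct ρ a := by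
  funext ν y
  show obval a (reflPt ρ y) (reflPt ρ (y + unitVec ν)) = ((rsgn ρ ν : ℝ) : ℂ) * a ν (twist ρ ν y)
  rw [reflPt_add]
  by_cases h : ν = ρ
  · subst h
    rw [reflPt_unitVec_self, ← sub_eq_add_neg, obval_bond_rev', rsgn_self]
    simp [twist, sv]
  · rw [reflPt_unitVec_of_ne h, obval_bond, rsgn_of_ne h]
    simp [twist, sv, h]

/-- **(5.3) ⇒ the translation action**: with `s = τ_v⁻¹ = τ_{−v}`, `pull s B = τ_v B`. [cite: Balaban1987RG1, (5.3) p.292] -/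
theorem pull_trans (v : Pt d) (a : Fin d → Pt d → ℂ) : pull (fun y => y - v) a = transAct v a := by
  funext ν y
  show obval a (y - v) (y + unitVec ν - v) = a ν (y - v)
  rw [add_sub_right_comm, obval_bond]

/-! ## §3 How the quadratic form (5.43) transforms -/

/-- Re-indexing the pair sum by `r_π × r_π`. [folklore] -/
theorem tsum_permPt (σ : Equiv.Perm (Fin d)) (F : Pt d × Pt d → ℂ) :
    ∑' p : Pt d × Pt d, F (permPt σ p.1, permPt σ p.2) = ∑' p : Pt d × Pt d, F p :=
  Equiv.tsum_eq ((permEquiv σ).prodCongr (permEquiv σ)) F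

/-- Re-indexing the pair sum by `T_{ρ;μ} × T_{ρ;ν}`. [folklore] -/
theorem tsum_twist (ρ μ ν : Fin d) (F : Pt d × Pt d → ℂ) :
    ∑' p : Pt d × Pt d, F (twist ρ μ p.1, twist ρ ν p.2) = ∑' p : Pt d × Pt d, F p :=
  Equiv.tsum_eq ((twistEquiv ρ μ).prodCongr (twistEquiv ρ ν)) F

/-- Re-indexing the pair sum by the swap. [folklore] -/
theorem tsum_swap_pair (F : Pt d × Pt d → ℂ) :
    ∑' p : Pt d × Pt d, F (p.2, p.1) = ∑' p : Pt d × Pt d, F p :=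
  Equiv.tsum_eq (Equiv.prodComm (Pt d) (Pt d)) F

/-- The scalar pairing under an axis permutation of both fields: the kernel is composed with `r_π`. [folklore] -/
theorem spair_permPt (σ : Equiv.Perm (Fin d)) (R f g : Pt d → ℂ) :
    spair R (fun x => f (permPt σ.symm x)) (fun y => g (permPt σ.symm y)) = spair (fun z => R (permPt σ z)) f g := by
  unfold spair
  rw [← tsum_permPt σ (fun p : Pt d × Pt d => R (p.1 - p.2) * f (permPt σ.symm p.1) * g (permPt σ.symm p.2))]
  exact tsum_congr fun p => by rw [permPt_symm_permPt, permPt_symm_permPt, ← permPt_sub]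

/-- The scalar pairing with the fields exchanged: the kernel is transposed in `z ↦ −z`. [folklore] -/
theorem spair_swap (R f g : Pt d → ℂ) : spair R g f = spair (fun z => R (-z)) f g := by
  unfold spair
  rw [← tsum_swap_pair (fun p : Pt d × Pt d => R (p.1 - p.2) * g p.1 * f p.2)]
  exact tsum_congr fun p => by dsimp only; rw [neg_sub]; ring

/-- The permuted kernel family `((r_π ⊗ r_π)⁻¹-side) (K^π)_{μν}(z) = K_{π(μ)π(ν)}(r_π z)`. [cite: Balaban1987RG1, (5.6) p.292] -/
def permK (σ : Equiv.Perm (Fin d)) (K : Fin d → Fin d → Pt d → ℂ) : Fin d → Fin d → Pt d → ℂ :=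
  fun μ ν z => K (σ μ) (σ ν) (permPt σ z)

/-- The twisted-reflected kernel family `(K^ε)_{μν}(z) = ε_με_ν K_{μν}(R_{ρ;μν} z)`. [cite: Balaban1987RG1, (5.7) p.293] -/
def reflTwK (ρ : Fin d) (K : Fin d → Fin d → Pt d → ℂ) : Fin d → Fin d → Pt d → ℂ :=
  fun μ ν z => ((rsgn ρ μ : ℝ) : ℂ) * ((rsgn ρ ν : ℝ) : ℂ) * K μ ν (reflTwist ρ μ ν z)

/-- The exchanged kernel family `(K^s)_{μν}(z) = K_{νμ}(−z)`. [cite: Balaban1987RG1, (5.8) p.293] -/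
def swapK (K : Fin d → Fin d → Pt d → ℂ) : Fin d → Fin d → Pt d → ℂ := fun μ ν z => K ν μ (-z)

/-- **The form under an axis permutation of both fields**: `form K (r_π a) (r_π b) = form K^π a b`.
[cite: Balaban1987RG1, (5.4)/(5.6) p.292] -/
theorem form_permAct (K : Fin d → Fin d → Pt d → ℂ) (σ : Equiv.Perm (Fin d)) (a b : Fin d → Pt d → ℂ) :
    form K (permAct σ a) (permAct σ b) = form (permK σ K) a b := by
  have hS : ∀ μ ν, spair (K (σ μ) (σ ν)) (permAct σ a (σ μ)) (permAct σ b (σ ν)) =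
      spair (permK σ K μ ν) (a μ) (b ν) := by
    intro μ ν
    show spair (K (σ μ) (σ ν)) (fun y => a (σ.symm (σ μ)) (permPt σ.symm y))
        (fun y => b (σ.symm (σ ν)) (permPt σ.symm y)) = spair (fun z => K (σ μ) (σ ν) (permPt σ z)) (a μ) (b ν)
    simp only [Equiv.symm_apply_apply]
    exact spair_permPt σ (K (σ μ) (σ ν)) (a μ) (b ν)
  unfold form
  calc ∑ μ, ∑ ν, spair (K μ ν) (permAct σ a μ) (permAct σ b ν)
      = ∑ μ, ∑ ν, spair (K (σ μ) (σ ν)) (permAct σ a (σ μ)) (permAct σ b (σ ν)) := by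
        rw [← Equiv.sum_comp σ (fun μ => ∑ ν, spair (K μ ν) (permAct σ a μ) (permAct σ b ν))]
        exact Finset.sum_congr rfl fun μ _ =>
          (Equiv.sum_comp σ (fun ν => spair (K (σ μ) ν) (permAct σ a (σ μ)) (permAct σ b ν))).symm
    _ = ∑ μ, ∑ ν, spair (permK σ K μ ν) (a μ) (b ν) :=
        Finset.sum_congr rfl fun μ _ => Finset.sum_congr rfl fun ν _ => hS μ ν

/-- **The form under the reflection of one axis in both fields**: `form K (εa) (εb) = form K^ε a b`.
[cite: Balaban1987RG1, (5.4) p.292; (5.7) p.293] -/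
theorem form_reflAct (K : Fin d → Fin d → Pt d → ℂ) (ρ : Fin d) (a b : Fin d → Pt d → ℂ) :
    form K (reflAct ρ a) (reflAct ρ b) = form (reflTwK ρ K) a b := by
  simp only [form, spair, reflAct, reflTwK]
  refine Finset.sum_congr rfl fun μ _ => Finset.sum_congr rfl fun ν _ => ?_
  rw [← tsum_twist ρ μ ν (fun p : Pt d × Pt d =>
    K μ ν (p.1 - p.2) * ((rsgn ρ μ : ℝ) * a μ (twist ρ μ p.1)) * ((rsgn ρ ν : ℝ) * b ν (twist ρ ν p.2)))]
  exact tsum_congr fun p => by rw [twist_twist, twist_twist, twist_sub_twist]; ring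

/-- **The form with the fields exchanged**: `form K b a = form K^s a b`. [cite: Balaban1987RG1, (5.8) p.293] -/
theorem form_swap (K : Fin d → Fin d → Pt d → ℂ) (a b : Fin d → Pt d → ℂ) : form K b a = form (swapK K) a b := by
  unfold form
  rw [Finset.sum_comm]
  exact Finset.sum_congr rfl fun μ _ => Finset.sum_congr rfl fun ν _ => spair_swap (K ν μ) (a μ) (b ν)

/-- **The form under a translation of both fields is unchanged** (the kernel depends on `x − y` only: (5.8)₁ is
built into `form`). [cite: Balaban1987RG1, (5.8) p.293] -/
theorem form_transAct (K : Fin d → Fin d → Pt d → ℂ) (v : Pt d) (a b : Fin d → Pt d → ℂ) :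
    form K (transAct v a) (transAct v b) = form K a b := by
  simp only [form, spair, transAct]
  refine Finset.sum_congr rfl fun μ _ => Finset.sum_congr rfl fun ν _ => ?_
  rw [← tsum_shift_fst (fun p : Pt d × Pt d => K μ ν (p.1 - p.2) * a μ (p.1 - v) * b ν (p.2 - v)) v,
    ← tsum_shift_snd (fun p : Pt d × Pt d => K μ ν (p.1 + v - p.2) * a μ (p.1 + v - v) * b ν (p.2 - v)) v]
  exact tsum_congr fun p => by simp only [add_sub_cancel_right, add_sub_add_right_eq_sub]

/-- **The form determines the kernel** (test on bond fields, `B12Form543.form_bvec`). [folklore] -/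
theorem kernel_eq_of_form_eq {K K' : Fin d → Fin d → Pt d → ℂ}
    (h : ∀ a b, FinSuppV a → FinSuppV b → form K a b = form K' a b) : K = K' := by
  funext μ ν z
  have := h (bvec μ z) (bvec ν 0) (finSuppV_of_support (bvec_support μ z))
    (finSuppV_of_support (bvec_support ν 0))
  rwa [form_bvec, form_bvec, sub_zero] at this

/-! ## §4 The dictionary: (5.4) for the generators ⇔ (5.6), (5.7); symmetry ⇔ (5.8)₂ -/

/-- `ε_i(ρ)² = 1` in `ℂ`. [folklore] -/
theorem rsgnC_mul_self (ρ i : Fin d) : ((rsgn ρ i : ℝ) : ℂ) * ((rsgn ρ i : ℝ) : ℂ) = 1 := by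
  unfold rsgn; split_ifs <;> norm_num

/-- **(5.4) for axis permutations ⇔ (5.6)** (complex kernels): the form is invariant under `r_π` in both fields,
for all finitely supported fields, iff `K_{π(μ)π(ν)}(r_π z) = K_{μν}(z)`. [cite: Balaban1987RG1, (5.4)/(5.6) p.292] -/
theorem permK_eq_iff (K : Fin d → Fin d → Pt d → ℂ) (σ : Equiv.Perm (Fin d)) :
    permK σ K = K ↔ ∀ a b, FinSuppV a → FinSuppV b → form K (permAct σ a) (permAct σ b) = form K a b := by
  refine ⟨fun h a b _ _ => by rw [form_permAct, h], fun h => ?_⟩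
  exact kernel_eq_of_form_eq fun a b ha hb => (form_permAct K σ a b).symm.trans (h a b ha hb)

/-- **(5.6) in the printed two-point form**: `K^π = K` iff `K_{μν}(r_πx − r_πy) = K_{π⁻¹(μ)π⁻¹(ν)}(x − y)`
("Π_{μν}(rx, ry) = Π_{π^{-1}(μ),π^{-1}(ν)}(x, y)"). [cite: Balaban1987RG1, (5.6) p.292] -/
theorem permK_eq_iff_printed (K : Fin d → Fin d → Pt d → ℂ) (σ : Equiv.Perm (Fin d)) :
    permK σ K = K ↔ ∀ μ ν x y, K μ ν (permPt σ x - permPt σ y) = K (σ.symm μ) (σ.symm ν) (x - y) := by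
  constructor
  · intro h μ ν x y
    have := congrFun (congrFun (congrFun h (σ.symm μ)) (σ.symm ν)) (x - y)
    simp only [permK, Equiv.apply_symm_apply, permPt_sub] at this
    exact this
  · intro h
    funext μ ν z
    have := h (σ μ) (σ ν) z 0
    simp only [Equiv.symm_apply_apply, sub_zero, permPt_zero] at this
    exact this

/-- **(5.4) for single-axis reflections ⇔ (5.7)** (complex kernels): the form is invariant under `ε` (reflection of
the `ρ`-th axis) in both fields iff `K_{μν}(R_{ρ;μν}z) = ε_με_ν K_{μν}(z)`.
[cite: Balaban1987RG1, (5.4) p.292; (5.7) p.293] -/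
theorem reflTwK_eq_iff (K : Fin d → Fin d → Pt d → ℂ) (ρ : Fin d) :
    reflTwK ρ K = K ↔ ∀ a b, FinSuppV a → FinSuppV b → form K (reflAct ρ a) (reflAct ρ b) = form K a b := by
  refine ⟨fun h a b _ _ => by rw [form_reflAct, h], fun h => ?_⟩
  exact kernel_eq_of_form_eq fun a b ha hb => (form_reflAct K ρ a b).symm.trans (h a b ha hb)

/-- `K^ε = K` unfolded: `K_{μν}(R_{ρ;μν}z) = ε_με_ν K_{μν}(z)` for all `μ ν z`. [cite: Balaban1987RG1, (5.7) p.293] -/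
theorem reflTwK_eq_iff_covariant (K : Fin d → Fin d → Pt d → ℂ) (ρ : Fin d) :
    reflTwK ρ K = K ↔
      ∀ μ ν z, K μ ν (reflTwist ρ μ ν z) = ((rsgn ρ μ : ℝ) : ℂ) * ((rsgn ρ ν : ℝ) : ℂ) * K μ ν z := by
  constructor
  · intro h μ ν z
    have e := congrFun (congrFun (congrFun h μ) ν) z
    simp only [reflTwK] at e
    linear_combination ((rsgn ρ μ : ℝ) : ℂ) * ((rsgn ρ ν : ℝ) : ℂ) * e +
      (-(K μ ν (reflTwist ρ μ ν z)) * ((rsgn ρ ν : ℝ) : ℂ) * ((rsgn ρ ν : ℝ) : ℂ)) * rsgnC_mul_self ρ μ +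
      (-(K μ ν (reflTwist ρ μ ν z))) * rsgnC_mul_self ρ ν
  · intro h
    funext μ ν z
    simp only [reflTwK, h μ ν z]
    linear_combination (((rsgn ρ ν : ℝ) : ℂ) * ((rsgn ρ ν : ℝ) : ℂ) * K μ ν z) * rsgnC_mul_self ρ μ +
      K μ ν z * rsgnC_mul_self ρ ν

/-- **(5.7) in the printed two-point form**: `K_{μν}(T_{ρ;μ}x − T_{ρ;ν}y) = ε_με_ν K_{μν}(x − y)`
("Π_{μν}(εx − ((1−ε_μ)/2)e_μ, εy − ((1−ε_ν)/2)e_ν) = ε_με_νΠ_{μν}(x,y)") iff `K^ε = K`. [cite: Balaban1987RG1, (5.7) p.293] -/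
theorem reflTwK_eq_iff_printed (K : Fin d → Fin d → Pt d → ℂ) (ρ : Fin d) :
    reflTwK ρ K = K ↔
      ∀ μ ν x y, K μ ν (twist ρ μ x - twist ρ ν y) = ((rsgn ρ μ : ℝ) : ℂ) * ((rsgn ρ ν : ℝ) : ℂ) * K μ ν (x - y) := by
  rw [reflTwK_eq_iff_covariant]
  refine ⟨fun h μ ν x y => by rw [twist_sub_twist]; exact h μ ν (x - y), fun h μ ν z => ?_⟩
  have := h μ ν z 0
  rwa [twist_sub_twist, sub_zero] at this

/-- **Symmetry ⇔ (5.8)₂**: the form is symmetric on finitely supported fields iff `K_{μν}(z) = K_{νμ}(−z)`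
("Π_{μν}(x) = Π_{νμ}(−x)"). [cite: Balaban1987RG1, (5.8) p.293] -/
theorem swapK_eq_iff (K : Fin d → Fin d → Pt d → ℂ) :
    swapK K = K ↔ ∀ a b, FinSuppV a → FinSuppV b → form K b a = form K a b := by
  refine ⟨fun h a b _ _ => by rw [form_swap, h], fun h => ?_⟩
  exact kernel_eq_of_form_eq fun a b ha hb => (form_swap K a b).symm.trans (h a b ha hb)

/-! ## §5 The lineage's typed hypotheses on a real B12 kernel are exactly these invariances -/

/-- **`B12Beta.PermCovariant` ⇔ (5.4) for all axis permutations** of the quadratic form of the complexified kernel.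
[cite: Balaban1987RG1, (5.4)/(5.6) p.292; (1.21) p.264] -/
theorem permCovariant_iff (P : B12Beta.Kernel d) :
    B12Beta.PermCovariant P ↔ ∀ (σ : Equiv.Perm (Fin d)) (a b : Fin d → Pt d → ℂ), FinSuppV a → FinSuppV b →
      form (ofRealK P) (permAct σ a) (permAct σ b) = form (ofRealK P) a b := by
  have key : ∀ σ : Equiv.Perm (Fin d), permK σ (ofRealK P) = ofRealK P ↔
      ∀ μ ν z, P (σ μ) (σ ν) (z ∘ σ.symm) = P μ ν z := by
    intro σ
    constructor
    · intro h μ ν z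
      have := congrFun (congrFun (congrFun h μ) ν) z
      simp only [permK, ofRealK, ofReal] at this
      simp only [Function.comp_def]
      exact_mod_cast this
    · intro h
      funext μ ν z
      have := h μ ν z
      simp only [Function.comp_def] at this
      simp only [permK, ofRealK, ofReal]
      exact_mod_cast this
  constructor
  · intro h σ
    exact (permK_eq_iff _ σ).1 ((key σ).2 (h σ))
  · intro h σ
    exact (key σ).1 ((permK_eq_iff _ σ).2 (h σ))

/-- **`B12Transverse536.ReflCovariant` ⇔ (5.4) for all single-axis reflections** of the quadratic form of the
complexified kernel — the sign `ε_με_ν` and the shifts of (5.7) being those FORCED by (5.3) (`pull_reflPt`).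
[cite: Balaban1987RG1, (5.4) p.292; (5.7) p.293] -/
theorem reflCovariant_iff (P : B12Beta.Kernel d) :
    ReflCovariant P ↔ ∀ (ρ : Fin d) (a b : Fin d → Pt d → ℂ), FinSuppV a → FinSuppV b →
      form (ofRealK P) (reflAct ρ a) (reflAct ρ b) = form (ofRealK P) a b := by
  have key : ∀ ρ, reflTwK ρ (ofRealK P) = ofRealK P ↔
      ∀ μ ν z, P μ ν (reflTwist ρ μ ν z) = rsgn ρ μ * rsgn ρ ν * P μ ν z := by
    intro ρ
    rw [reflTwK_eq_iff_covariant]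
    refine forall_congr' fun μ => forall_congr' fun ν => forall_congr' fun z => ?_
    simp only [ofRealK, ofReal]
    constructor
    · intro h; exact_mod_cast h
    · intro h; exact_mod_cast h
  constructor
  · intro h ρ
    exact (reflTwK_eq_iff _ ρ).1 ((key ρ).2 fun μ ν z => h ρ μ ν z)
  · intro h ρ μ ν z
    exact (key ρ).1 ((reflTwK_eq_iff _ ρ).2 (h ρ)) μ ν z

/-- **(5.8)₂ for a real kernel ⇔ symmetry of the form.** [cite: Balaban1987RG1, (5.8) p.293] -/
theorem symmetric_iff (P : B12Beta.Kernel d) :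
    (∀ μ ν z, P μ ν z = P ν μ (-z)) ↔ ∀ a b : Fin d → Pt d → ℂ, FinSuppV a → FinSuppV b →
      form (ofRealK P) b a = form (ofRealK P) a b := by
  rw [← swapK_eq_iff]
  constructor
  · intro h
    funext μ ν z
    simp only [swapK, ofRealK, ofReal]
    exact_mod_cast (h μ ν z).symm
  · intro h μ ν z
    have := congrFun (congrFun (congrFun h μ) ν) z
    simp only [swapK, ofRealK, ofReal] at this
    exact_mod_cast this.symm

/-! ## §6 Gauge invariance of the form ⇔ the Ward identities (5.9) -/

/-- The pairing through the zero kernel vanishes. [folklore] -/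
theorem spair_zero_kernel (f g : Pt d → ℂ) : spair (fun _ => 0) f g = 0 := by simp [spair]

/-- **Summation by parts, kernel ↔ right field, forward version**: `Σ (∂_νR)(x − y) f(x) g(y) =
Σ R(x − y) f(x) (∂_ν g)(y)`. [folklore] -/
theorem spair_fdelta_kernel_right (R : Pt d → ℂ) (ν : Fin d) {f g : Pt d → ℂ} (hf : FinSupp f)
    (hg : FinSupp g) : spair (fdelta ν R) f g = spair R f (fdelta ν g) := by
  have hF := summable_spairFun R hf hg
  have hH := summable_spairFun (fun z => R (z + unitVec ν)) hf hg
  have hG := summable_spairFun R hf (hg.shift (unitVec ν))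
  have hre : ∑' p : Pt d × Pt d, R (p.1 - p.2 + unitVec ν) * f p.1 * g p.2 =
      ∑' p : Pt d × Pt d, R (p.1 - p.2) * f p.1 * g (p.2 + unitVec ν) := by
    rw [← tsum_shift_snd (fun p : Pt d × Pt d => R (p.1 - p.2 + unitVec ν) * f p.1 * g p.2) (unitVec ν)]
    exact tsum_congr fun p => by rw [← sub_sub, sub_add_cancel]
  unfold spair
  calc ∑' p : Pt d × Pt d, fdelta ν R (p.1 - p.2) * f p.1 * g p.2
      = ∑' p : Pt d × Pt d, (R (p.1 - p.2 + unitVec ν) * f p.1 * g p.2 - R (p.1 - p.2) * f p.1 * g p.2) :=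
        tsum_congr fun p => by simp only [B12Rep537.fdelta]; ring
    _ = ∑' p : Pt d × Pt d, R (p.1 - p.2 + unitVec ν) * f p.1 * g p.2 -
          ∑' p : Pt d × Pt d, R (p.1 - p.2) * f p.1 * g p.2 := hH.tsum_sub hF
    _ = ∑' p : Pt d × Pt d, R (p.1 - p.2) * f p.1 * g (p.2 + unitVec ν) -
          ∑' p : Pt d × Pt d, R (p.1 - p.2) * f p.1 * g p.2 := by rw [hre]
    _ = ∑' p : Pt d × Pt d, (R (p.1 - p.2) * f p.1 * g (p.2 + unitVec ν) - R (p.1 - p.2) * f p.1 * g p.2) :=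
        (hG.tsum_sub hF).symm
    _ = ∑' p : Pt d × Pt d, R (p.1 - p.2) * f p.1 * fdelta ν g p.2 :=
        tsum_congr fun p => by simp only [B12Rep537.fdelta]; ring

/-- **The form against a pure gauge on the LEFT**: `form K (∂λ) b = Σ_ν spair (Σ_μ Δ_μK_{μν}) λ b_ν` (summation by
parts puts the backward-looking divergence `Σ_μ ∂*_μ` of (5.9)₁ on the kernel). [cite: Balaban1987RG1, (5.9) p.293; (4.15) p.284] -/
theorem form_grad_left (K : Fin d → Fin d → Pt d → ℂ) {lam : Pt d → ℂ} {b : Fin d → Pt d → ℂ} (hlam : FinSupp lam)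
    (hb : FinSuppV b) : form K (grad lam) b = ∑ ν, spair (fun z => ∑ μ, delta μ (K μ ν) z) lam (b ν) := by
  unfold form
  rw [Finset.sum_comm]
  refine Finset.sum_congr rfl fun ν _ => ?_
  rw [spair_sum_kernel _ _ hlam (hb.comp ν)]
  exact Finset.sum_congr rfl fun μ _ => (spair_delta_kernel (K μ ν) μ hlam (hb.comp ν)).symm

/-- **The form against a pure gauge on the RIGHT**: `form K a (∂λ) = Σ_μ spair (Σ_ν ∂_νK_{μν}) a_μ λ` (the forward
divergence `Σ_ν ∂_ν` of (5.9)₂ on the kernel). [cite: Balaban1987RG1, (5.9) p.293; (4.15) p.284] -/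
theorem form_grad_right (K : Fin d → Fin d → Pt d → ℂ) {a : Fin d → Pt d → ℂ} {lam : Pt d → ℂ} (ha : FinSuppV a)
    (hlam : FinSupp lam) : form K a (grad lam) = ∑ μ, spair (fun z => ∑ ν, fdelta ν (K μ ν) z) (a μ) lam := by
  unfold form
  refine Finset.sum_congr rfl fun μ _ => ?_
  rw [spair_sum_kernel _ _ (ha.comp μ) hlam]
  exact Finset.sum_congr rfl fun ν _ => (spair_fdelta_kernel_right (K μ ν) ν (ha.comp μ) hlam).symm

/-- `δ₀(· − x₀)` vanishes off `{x₀}`. [folklore] -/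
theorem dirac_sub_support (x₀ : Pt d) : ∀ x, x ∉ ({x₀} : Finset (Pt d)) → dirac (x - x₀) = 0 := by
  intro x hx
  rw [Finset.mem_singleton] at hx
  simp [dirac, sub_eq_zero, hx]

/-- **(5.9)₁ ⇔ gauge invariance of the form in the left (δB) argument**: `Σ_μ ∂*_μK_{μν} = 0` (`WardB`, backward-
looking divergence) iff `form K (∂λ) b = 0` for all finitely supported `λ`, `b` — "The gauge invariance, expressed in
the first identity (4.15), implies (5.9)" at the level of the quadratic form. [cite: Balaban1987RG1, (5.9) p.293; (4.15) p.284] -/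
theorem wardB_iff_gauge_left (K : Fin d → Fin d → Pt d → ℂ) :
    WardB K ↔ ∀ (lam : Pt d → ℂ) (b : Fin d → Pt d → ℂ), FinSupp lam → FinSuppV b → form K (grad lam) b = 0 := by
  constructor
  · intro h lam b hlam hb
    rw [form_grad_left K hlam hb]
    refine Finset.sum_eq_zero fun ν _ => ?_
    rw [show (fun z => ∑ μ, delta μ (K μ ν) z) = fun _ => (0 : ℂ) from funext fun z => h ν z]
    exact spair_zero_kernel _ _
  · intro h ν x₀
    have hlam : FinSupp fun x : Pt d => dirac (x - x₀) := ⟨{x₀}, dirac_sub_support x₀⟩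
    have hb : FinSuppV (bvec ν (0 : Pt d)) := finSuppV_of_support (bvec_support ν 0)
    have e := h _ _ hlam hb
    rw [form_grad_left K hlam hb] at e
    have ev : ∀ ν', spair (fun z => ∑ μ, delta μ (K μ ν') z) (fun x => dirac (x - x₀)) (bvec ν 0 ν') =
        if ν' = ν then ∑ μ, delta μ (K μ ν) x₀ else 0 := by
      intro ν'
      rw [spair_eq_sum (A := {x₀}) (B := {0}) (dirac_sub_support x₀) (bvec_support ν 0 ν')]
      simp only [Finset.sum_singleton, sub_zero, sub_self, dirac_zero, mul_one, bvec, kron]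
      split_ifs with h'
      · subst h'; simp
      · simp
    simp only [ev, Finset.sum_ite_eq', Finset.mem_univ, if_true] at e
    exact e

/-- **(5.9)₂ ⇔ gauge invariance of the form in the right (B) argument**: `Σ_ν ∂_νK_{μν} = 0` (`WardB₂`, forward
divergence) iff `form K a (∂λ) = 0` for all finitely supported `a`, `λ`. [cite: Balaban1987RG1, (5.9) p.293; (4.15) p.284] -/
theorem wardB₂_iff_gauge_right (K : Fin d → Fin d → Pt d → ℂ) :
    WardB₂ K ↔ ∀ (a : Fin d → Pt d → ℂ) (lam : Pt d → ℂ), FinSuppV a → FinSupp lam → form K a (grad lam) = 0 := by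
  constructor
  · intro h a lam ha hlam
    rw [form_grad_right K ha hlam]
    refine Finset.sum_eq_zero fun μ _ => ?_
    rw [show (fun z => ∑ ν, fdelta ν (K μ ν) z) = fun _ => (0 : ℂ) from funext fun z => h μ z]
    exact spair_zero_kernel _ _
  · intro h μ x₀
    have hlam : FinSupp fun x : Pt d => dirac (x - 0) := ⟨{0}, dirac_sub_support 0⟩
    have ha : FinSuppV (bvec μ x₀) := finSuppV_of_support (bvec_support μ x₀)
    have e := h _ _ ha hlam
    rw [form_grad_right K ha hlam] at e
    have ev : ∀ μ', spair (fun z => ∑ ν, fdelta ν (K μ' ν) z) (bvec μ x₀ μ') (fun x => dirac (x - 0)) =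
        if μ' = μ then ∑ ν, fdelta ν (K μ ν) x₀ else 0 := by
      intro μ'
      rw [spair_eq_sum (A := {x₀}) (B := {0}) (bvec_support μ x₀ μ') (dirac_sub_support 0)]
      simp only [Finset.sum_singleton, sub_zero, sub_self, dirac_zero, mul_one, bvec, kron]
      split_ifs with h'
      · subst h'; simp
      · simp
    simp only [ev, Finset.sum_ite_eq', Finset.mem_univ, if_true] at e
    exact e

/-- The cell's real first Ward identity is the complex one for the complexified kernel. [folklore] -/
theorem wardFirst_iff_wardB (P : B12Beta.Kernel d) : WardFirst P ↔ WardB (ofRealK P) := by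
  refine ⟨wardB_ofReal, fun h ν x => ?_⟩
  have := h ν x
  simp only [delta, ofRealK, ofReal] at this
  exact_mod_cast this

/-- **`B12Transverse536.WardFirst` ⇔ left gauge invariance of the form of the complexified kernel.**
[cite: Balaban1987RG1, (5.9) p.293; (4.15) p.284] -/
theorem wardFirst_iff_gauge_left (P : B12Beta.Kernel d) :
    WardFirst P ↔ ∀ (lam : Pt d → ℂ) (b : Fin d → Pt d → ℂ), FinSupp lam → FinSuppV b →
      form (ofRealK P) (grad lam) b = 0 := by
  rw [wardFirst_iff_wardB, wardB_iff_gauge_left]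

/-- **(5.9)₂ from (5.9)₁ and the symmetry (5.8)₂**: for a kernel with `K_{μν}(z) = K_{νμ}(−z)` the two Ward
identities are equivalent (`B12WardLeadingForm.wardB₂_iff_wardB`). [cite: Balaban1987RG1, (5.8)-(5.9) p.293] -/
theorem wardB₂_iff_wardB_of_symmetric {K : Fin d → Fin d → Pt d → ℂ} (hK : swapK K = K) : WardB₂ K ↔ WardB K := by
  rw [wardB₂_iff_wardB]
  exact iff_of_eq (congrArg WardB hK)

/-! ## §7 The abstract origin of (5.4): invariance of a function ⇒ invariance of its Hessian at 0 -/

section Abstract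

variable {𝕜 : Type*} [NontriviallyNormedField 𝕜] {E F : Type*} [NormedAddCommGroup E] [NormedSpace 𝕜 E]
  [NormedAddCommGroup F] [NormedSpace 𝕜 F]

/-- **(5.2) ⇒ (5.4), abstract**: if `f ∘ L = f` for a continuous linear map `L` ("𝐄^{(j)}(U_j(exp irB)) =
𝐄^{(j)}(U_j(exp iB))", `r` acting linearly on the field by (5.3)) and `f` is `C²`, then the second derivative at
`0` is `L`-invariant in both slots: `D²f(0)(Lm₀, Lm₁) = D²f(0)(m₀, m₁)` ("Π(rb, rb′) = Π(b, b′)" for the Hessian in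
bond coordinates, (5.1)). [cite: Balaban1987RG1, (5.1)-(5.4) p.292] -/
theorem iteratedFDeriv_two_invariant {f : E → F} (hf : ContDiff 𝕜 2 f) (L : E →L[𝕜] E) (hinv : f ∘ L = f)
    (m : Fin 2 → E) : iteratedFDeriv 𝕜 2 f 0 (fun i => L (m i)) = iteratedFDeriv 𝕜 2 f 0 m := by
  conv_rhs => rw [← hinv, L.iteratedFDeriv_comp_right hf 0 le_rfl]
  simp only [ContinuousMultilinearMap.compContinuousLinearMap_apply, map_zero]

/-- The same in the `fderiv ∘ fderiv` spelling of `…B12Ward414`: `D²f(0)(Lv)(Lw) = D²f(0)(v)(w)`.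
[cite: Balaban1987RG1, (5.1)-(5.4) p.292] -/
theorem hessian_invariant {f : E → F} (hf : ContDiff 𝕜 2 f) (L : E →L[𝕜] E) (hinv : f ∘ L = f) (v w : E) :
    fderiv 𝕜 (fderiv 𝕜 f) 0 (L v) (L w) = fderiv 𝕜 (fderiv 𝕜 f) 0 v w := by
  have h := iteratedFDeriv_two_invariant hf L hinv ![v, w]
  rw [iteratedFDeriv_two_apply, iteratedFDeriv_two_apply] at h
  simpa using h

end Abstract

/-! ## §8 Capstone: (5.43) complete from (5.10) and the INVARIANCES of the form -/

/-- **(5.43) complete from (5.10) + the invariance (5.4) of the quadratic form under the generators of the lattice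
point group + its left gauge invariance (4.15)₁** (instead of the kernel-level (5.6), (5.7), (5.9)₁): for a real
kernel family with the decay (5.10) of every component whose complexified form `form Π` is invariant under every axis
permutation and every single-axis reflection acting on both fields by (5.3), and annihilates pure gauges `∂λ` in the
`δB` slot, the conclusion of `B12Form543.form543_of_symmetries` holds, `β = Σ_x Π_{μ₀ν₀}(x)x_{μ₀}x_{ν₀}` (`μ₀ ≠ ν₀`).
[cite: Balaban1987RG1, (5.2)-(5.10) pp.292-293; (5.43)-(5.44) p.297] -/
theorem form543_of_invariance {P : B12Beta.Kernel d} {C δ₁ : ℝ} (hδ : 0 < δ₁)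
    (h510 : ∀ μ ν, B12Sec2to5.Decay510 (P μ ν) C δ₁)
    (hperm : ∀ (σ : Equiv.Perm (Fin d)) (a b : Fin d → Pt d → ℂ), FinSuppV a → FinSuppV b →
      form (ofRealK P) (pull (permPt σ.symm) a) (pull (permPt σ.symm) b) = form (ofRealK P) a b)
    (hrefl : ∀ (ρ : Fin d) (a b : Fin d → Pt d → ℂ), FinSuppV a → FinSuppV b →
      form (ofRealK P) (pull (reflPt ρ) a) (pull (reflPt ρ) b) = form (ofRealK P) a b)
    (hgauge : ∀ (lam : Pt d → ℂ) (b : Fin d → Pt d → ℂ), FinSupp lam → FinSuppV b →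
      form (ofRealK P) (grad lam) b = 0)
    {μ₀ ν₀ : Fin d} (h0 : μ₀ ≠ ν₀) {a b : Fin d → Pt d → ℂ} (ha : FinSuppV a) (hb : FinSuppV b) :
    form (ofRealK P) a b = ((B12Beta.secondMoment P μ₀ ν₀ : ℝ) : ℂ) * fsqB a b +
        ∑ μ, ∑ ν, ∑ μs : Fin 3 → Fin d,
          spair (rem538 (ofReal (P μ ν)) ((B12Beta.secondMoment P μ₀ ν₀ : ℝ) : ℂ) μ ν μs)
            (fdeltaIter 3 μs (a μ)) (b ν) ∧
      ∀ (μ ν : Fin d) (μs : Fin 3 → Fin d) (z : Pt d),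
        ‖rem538 (ofReal (P μ ν)) ((B12Beta.secondMoment P μ₀ ν₀ : ℝ) : ℂ) μ ν μs z‖ ≤
          K δ₁ d ^ 3 * (C + ‖((B12Beta.secondMoment P μ₀ ν₀ : ℝ) : ℂ)‖ * MQ δ₁ d) * Real.exp (-δ₁ * l1 z) := by
  have hperm' := (permCovariant_iff P).2 fun σ a b ha hb => by
    rw [← pull_permPt, ← pull_permPt]; exact hperm σ a b ha hb
  have hrefl' := (reflCovariant_iff P).2 fun ρ a b ha hb => by
    rw [← pull_reflPt, ← pull_reflPt]; exact hrefl ρ a b ha hb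
  exact form543_of_symmetries hδ h510 hperm' hrefl' ((wardFirst_iff_gauge_left P).2 hgauge) h0 ha hb

end

end Literature.MathematicalPhysics.QuantumFieldTheory.Balaban1983to89.B12Covariance54
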